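/-
Copyright (c) 2026 the pub-hodgecm-mathlib formalisation cell (harness21).  Prover seat hodgecm-mathlib-K2E4-p11 (g6), Track B ∕ K2-LIT, h413 = `stmt-HodgeConjecture-24833`,
line `K2_E1_TraceFormulaBeta`, campaign «5Res ENDGAME BY FAMILIES», T4b-multi (dealer K2E1-plan (g7) deals (164)∕(178)): the contour shift of the inner product formula of a
pseudo-Eisenstein family of `U(1,1)_{L∕L⁺}` from `Re z = σ₀` to the unitary axis `Re z = ½`, across FINITELY MANY simple real poles of the axis scalar — hypothesis-first on the scalar,
output in ★ T5a ED. 2's finset currency.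
-/
import Summits.HodgeConjecture.HodgeConjecture.Theorems.K2E1VerticalLineContourShiftMulti     -- ★ C4 p859951 (this seat): `integral_vertical_eq_integral_vertical_add_sum_residues` (finset of simple real poles), Mathlib-only over ★ T4a
import Summits.HodgeConjecture.HodgeConjecture.Theorems.K2E1PseudoEisensteinContourShiftCMTwo  -- ★ T4b p859770 (K2E1-p12): §1 uniform Mellin bounds on strips (`exists_norm_mellin_vertical_le_div_sq_of_mem_Icc`, `exists_norm_mellin_le_of_re_mem_Icc`, `differentiable_conj_mellin_reflect`); brings ★ A
import HarnessLib

/-!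
# T4b-multi — `K2E1PseudoEisensteinContourShiftMultiCMTwo`: the inner-product integrand of a pseudo-Eisenstein family moved from `Re z = σ₀` to `Re z = ½`, picking up the residues at
# FINITELY MANY simple real poles `c ∈ (½, σ₀)` of the axis scalar — output = the `hIP` input of ★ T5a ED. 2 `plancherelForm_of_innerProductFormula_finset`

Track B ∕ K2-LIT, crux h413 = `stmt-HodgeConjecture-24833`, route of record `HCCMUnconditional`; cell `hodgecm-mathlib`, squad K2, ENGINE E1; ROADCARD «5Res ENDGAME BY FAMILIES» (dealer
K2E1-plan (g7), deals (164)∕(178): «T4b-multi = C4's pseudo-Eisenstein print in ★ T5a ED.2's finset currency»).  THEOREMS ONLY (no `def`, no `instance`, no `notation`, no `sorry`; default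
heartbeats); lane `--supports stmt-HodgeConjecture-24833 --as helper` (count-neutral).

THE MATHEMATICS ([MoeglinWaldspurger1995, II.2.1–II.2.4, IV.1.11]; [Titchmarsh1939, §3.1, §3.12]; [Titchmarsh1948, §1.29]).  The inner product of two pseudo-Eisenstein series of ONE
cuspidal-datum family of `U(1,1)_{L∕L⁺}` is `⟪θ, θ′⟫ = C·(2π)⁻¹ ∫_ℝ F(σ₀+iy) dy`, `σ₀ > 1` say, with `F(z) = f̃(z)·(conj f̃′(1−z̄) + s(z)·conj f̃′(z̄))`, `f̃ = mellin f(−·)`,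
`f, f′ ∈ C²_c((0,∞))`, and `s` the AXIS SCALAR of the family (radial family: `(ν𝓕)⁻¹·c`, ★ T4b; a self-dual unramified `χ`-family: the scalar through which `M(z, χ)` acts on the
`K_U`-fixed line), meromorphic near the closed strip `{½ ≤ Re z ≤ σ₀}` with FINITELY MANY simple REAL poles `c ∈ (½, σ₀)` (residues `r_c`), bounded on the strip at height `|Im z| ≥ 1`
(★ T1 ∕ T1-χ currency).  ★ T4b treats the one pole `c = 1` of the radial family with ★ T4a; this file treats the finset with ★ C4: the three Mellin factors are entire with `f̃ = O(y⁻²)`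
uniformly on strips (★ T4b §1), the integrand is holomorphic off the poles with `(z − c)·F(z) → r_c·f̃(c)·conj f̃′(c)` at each pole (`conj c = c`), and `‖F(x+iy)‖ ≤ K∕y²` on the strip
(the strip bound on `s` extends to the axis by continuity, §1).  HENCE (§3 HEAD) **`pseudoEisenstein_contourShift_multi_of_letters`**: from `hIP : IP = C·((2π)⁻¹ ∫_ℝ F(σ₀+iy) dy)`,
**`IP = C·(Σ_{c ∈ S} r_c·f̃(c)·conj f̃′(c)) + C·((2π)⁻¹ ∫_ℝ F(½+iy) dy)`** with `y ↦ F(½+iy) ∈ L¹` — LITERALLY the hypothesis `hIP` of ★ T5a ED. 2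
`plancherelForm_of_innerProductFormula_finset` at `(ι, J, z, ρ, Φ, Ψ, s, k) := (ℝ, S, id, r, mellin f, mellin f′, s, (2π)⁻¹)` (and `S = ∅` for pole-free — off-dual — families).
* §1 the scalar on the closed strip off a finite real pole set: `norm_le_of_re_mem_Icc_of_finset` (closure of the strip bound at `Re z = ½`), `continuous_scalar_vertical_of_finset`.
* §2 the integrand: `differentiableOn_innerProductIntegrand'` (any set), `tendsto_sub_mul_innerProductIntegrand` (residue at a real pole), `exists_norm_innerProductIntegrand_le_div_sq_of_finset`,
  `integrable_innerProductIntegrand_vertical_of_finset`, **`integral_innerProductIntegrand_eq_add_sum_residues`** (★ C4 applied).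
* §3 HEAD **`pseudoEisenstein_contourShift_multi_of_letters`**.
HONEST LABEL: HC_CM is proved only modulo the 7 printed citations (2 remaining named inputs: hLiu418 = `stmt-HodgeConjecture-24832`, h413 = `stmt-HodgeConjecture-24833`) until rung 0
closes; this file asserts no named fact, closes no socket; count-neutral; letters: `hs`∕`hr` (meromorphy of the axis scalar near the closed strip with its finset of simple real poles),
`hB` (strip bound, ★ T1∕T1-χ currency), `hIP` (the family's inner-product formula, ★ FILE D ∕ f3-χ currency).

## References
* [MoeglinWaldspurger1995] C. Mœglin, J.-L. Waldspurger, *Spectral decomposition and Eisenstein series* (1995), II.2.1–II.2.4, IV.1.11.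
* [Titchmarsh1939] E. C. Titchmarsh, *The Theory of Functions* (2nd ed., 1939), §3.1, §3.12.
* [Titchmarsh1948] E. C. Titchmarsh, *Introduction to the Theory of Fourier Integrals* (1948), §1.29, Thm 71–72.
-/

set_option autoImplicit false
set_option linter.dupNamespace false  -- the mandated namespace repeats the summit's segment (`HodgeConjecture.HodgeConjecture`)

noncomputable section

open MeasureTheory Measure Set Filter Topology Complex
open scoped Real ComplexConjugate
open Summit.HodgeConjecture.HodgeConjecture.Cruxes.H413.K2E1MellinPaleyWienerHalfLine (differentiable_mellin)
open Summit.HodgeConjecture.HodgeConjecture.Cruxes.H413.K2E1VerticalLineContourShift (integrable_of_continuous_of_sq_decay)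
open Summit.HodgeConjecture.HodgeConjecture.Cruxes.H413.K2E1VerticalLineContourShiftMulti (integral_vertical_eq_integral_vertical_add_sum_residues)
open Summit.HodgeConjecture.HodgeConjecture.Cruxes.H413.K2E1PseudoEisensteinContourShiftCMTwo (exists_norm_mellin_le_of_re_mem_Icc exists_norm_mellin_vertical_le_div_sq_of_mem_Icc
  differentiable_conj_mellin_reflect)

namespace Summit.HodgeConjecture.HodgeConjecture.Cruxes.H413.K2E1PseudoEisensteinContourShiftMultiCMTwo

/-! ## §1 The axis scalar on the closed strip off a finite set of real poles in `(½, σ₀)` -/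

section Scalar

variable {s : ℂ → ℂ} {U : Set ℂ} {σ₀ B : ℝ} {S : Finset ℝ}

/-- A point of the closed strip with `Re z ∉ S` is not a pole. [folklore] -/
theorem not_mem_image_of_re {S : Finset ℝ} {z : ℂ} (hz : ∀ c ∈ S, z.re ≠ c) : z ∉ ((S.image fun c : ℝ => (c : ℂ)) : Set ℂ) := by
  rw [Finset.coe_image]
  rintro ⟨c, hc, hcz⟩
  exact hz c hc (by rw [← hcz, ofReal_re])

/-- A point with `Im z ≠ 0` is not a (real) pole. [folklore] -/
theorem not_mem_image_of_im_ne_zero {S : Finset ℝ} {z : ℂ} (hz : z.im ≠ 0) : z ∉ ((S.image fun c : ℝ => (c : ℂ)) : Set ℂ) := by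
  rw [Finset.coe_image]
  rintro ⟨c, -, hcz⟩
  exact hz (by rw [← hcz, ofReal_im])

/-- **THE STRIP BOUND EXTENDS TO THE UNITARY AXIS** (finite real pole set in `(½, σ₀)`): if `s` is holomorphic on `U ∖ S` (`U` open ⊇ the closed strip, the poles real with `½ < c`)
and `‖s z‖ ≤ B` on `½ < Re z ≤ σ₀, |Im z| ≥ 1`, then `‖s z‖ ≤ B` on `½ ≤ Re z ≤ σ₀, |Im z| ≥ 1` (`s(½+it) = lim_{x↓0} s(½+x+it)`; the twin of ★ T4b `norm_le_of_re_mem_Icc`).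
[cite: MoeglinWaldspurger1995, IV.1.11] -/
theorem norm_le_of_re_mem_Icc_of_finset (hUo : IsOpen U) (hUs : {z : ℂ | 1 / 2 ≤ z.re ∧ z.re ≤ σ₀} ⊆ U) (hs : DifferentiableOn ℂ s (U \ ((S.image fun c : ℝ => (c : ℂ)) : Set ℂ)))
    (hS : ∀ c ∈ S, 1 / 2 < c) (hσ₀ : 1 / 2 < σ₀) (hB : ∀ z : ℂ, 1 / 2 < z.re → z.re ≤ σ₀ → 1 ≤ |z.im| → ‖s z‖ ≤ B) :
    ∀ z : ℂ, 1 / 2 ≤ z.re → z.re ≤ σ₀ → 1 ≤ |z.im| → ‖s z‖ ≤ B := by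
  intro z hz₁ hz₂ hzi
  rcases lt_or_eq_of_le hz₁ with h | h
  · exact hB z h hz₂ hzi
  · -- `Re z = ½`: approach from the right
    have hzS : z ∉ ((S.image fun c : ℝ => (c : ℂ)) : Set ℂ) := not_mem_image_of_re fun c hc => by rw [← h]; exact (hS c hc).ne
    have hzU : z ∈ U \ ((S.image fun c : ℝ => (c : ℂ)) : Set ℂ) := ⟨hUs ⟨hz₁, hz₂⟩, hzS⟩
    have hopen : IsOpen (U \ ((S.image fun c : ℝ => (c : ℂ)) : Set ℂ)) := hUo.sdiff (Finset.finite_toSet _).isClosed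
    have hcont : ContinuousAt s z := (hs.differentiableAt (hopen.mem_nhds hzU)).continuousAt
    have hlim : Tendsto (fun x : ℝ => ‖s (z + x)‖) (𝓝[>] 0) (𝓝 ‖s z‖) := by
      have h1 : Tendsto (fun x : ℝ => z + (x : ℂ)) (𝓝 0) (𝓝 z) := by
        have h2 : Continuous fun x : ℝ => z + (x : ℂ) := continuous_const.add continuous_ofReal
        have h3 := h2.tendsto 0
        simpa using h3
      exact ((hcont.tendsto.comp h1).norm).mono_left nhdsWithin_le_nhds
    refine le_of_tendsto hlim ?_
    filter_upwards [Ioo_mem_nhdsGT (show (0 : ℝ) < σ₀ - 1 / 2 by linarith)] with x hx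
    refine hB _ ?_ ?_ ?_
    · simp only [add_re, ofReal_re]; linarith [hx.1]
    · simp only [add_re, ofReal_re]; linarith [hx.2]
    · simpa only [add_im, ofReal_im, add_zero] using hzi

/-- `y ↦ s(σ+iy)` is continuous for `σ ∈ [½, σ₀]`, `σ ∉ S` (the line lies in `U ∖ S`). [folklore] -/
theorem continuous_scalar_vertical_of_finset (hUs : {z : ℂ | 1 / 2 ≤ z.re ∧ z.re ≤ σ₀} ⊆ U) (hs : DifferentiableOn ℂ s (U \ ((S.image fun c : ℝ => (c : ℂ)) : Set ℂ)))
    {σ : ℝ} (hσ₁ : 1 / 2 ≤ σ) (hσ₂ : σ ≤ σ₀) (hσ : ∀ c ∈ S, σ ≠ c) : Continuous fun y : ℝ => s ((σ : ℂ) + y * I) := by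
  have hline : ∀ y : ℝ, (σ : ℂ) + y * I ∈ U \ ((S.image fun c : ℝ => (c : ℂ)) : Set ℂ) := fun y =>
    ⟨hUs ⟨by simpa using hσ₁, by simpa using hσ₂⟩, not_mem_image_of_re fun c hc => by simpa using hσ c hc⟩
  exact hs.continuousOn.comp_continuous (continuous_const.add (continuous_ofReal.mul continuous_const)) hline

end Scalar

/-! ## §2 The integrand `F(z) = f̃(z)·(conj f̃′(1−z̄) + s(z)·conj f̃′(z̄))` off a finite set of real poles -/

section Integrand

variable {f f' : ℝ → ℂ} {s : ℂ → ℂ} {U : Set ℂ} {σ₀ B : ℝ} {S : Finset ℝ} {r : ℝ → ℂ}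

/-- `F` is complex-differentiable wherever `s` is (★ A + Schwarz reflection for the Mellin factors). [cite: MoeglinWaldspurger1995, II.2.2] -/
theorem differentiableOn_innerProductIntegrand' (hf : ContDiff ℝ 2 f) (hfs : HasCompactSupport f) (hf0 : tsupport f ⊆ Ioi 0)
    (hf' : ContDiff ℝ 2 f') (hf's : HasCompactSupport f') (hf'0 : tsupport f' ⊆ Ioi 0) {V : Set ℂ} (hs : DifferentiableOn ℂ s V) :
    DifferentiableOn ℂ (fun z : ℂ => mellin f (-z) * (conj (mellin f' (-(1 - conj z))) + s z * conj (mellin f' (-conj z)))) V := by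
  obtain ⟨h2, h3⟩ := differentiable_conj_mellin_reflect hf'.continuous hf's hf'0
  have h1 : Differentiable ℂ fun z : ℂ => mellin f (-z) := (differentiable_mellin hf.continuous hfs hf0).comp differentiable_neg
  exact h1.differentiableOn.mul (h2.differentiableOn.add (hs.mul h3.differentiableOn))

/-- **THE RESIDUE AT A REAL POLE `c`**: `(z − c)·F(z) → r_c·f̃(c)·conj f̃′(c)` as `z → c`, `z ≠ c` (`(z − c)s(z) → r_c`, the Mellin factors continuous at `c`, `conj c = c`;
`f̃(c) = mellin f (−c)`). [cite: MoeglinWaldspurger1995, II.2.4] -/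
theorem tendsto_sub_mul_innerProductIntegrand (hf : ContDiff ℝ 2 f) (hfs : HasCompactSupport f) (hf0 : tsupport f ⊆ Ioi 0)
    (hf' : ContDiff ℝ 2 f') (hf's : HasCompactSupport f') (hf'0 : tsupport f' ⊆ Ioi 0) {c : ℝ} {ρ : ℂ} (hr : Tendsto (fun z : ℂ => (z - c) * s z) (𝓝[≠] (c : ℂ)) (𝓝 ρ)) :
    Tendsto (fun z : ℂ => (z - c) * (mellin f (-z) * (conj (mellin f' (-(1 - conj z))) + s z * conj (mellin f' (-conj z)))))
      (𝓝[≠] (c : ℂ)) (𝓝 (ρ * (mellin f (-(c : ℂ)) * conj (mellin f' (-(c : ℂ)))))) := by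
  obtain ⟨h2, h3⟩ := differentiable_conj_mellin_reflect hf'.continuous hf's hf'0
  have h1 : Differentiable ℂ fun z : ℂ => mellin f (-z) := (differentiable_mellin hf.continuous hfs hf0).comp differentiable_neg
  have e : ∀ z : ℂ, (z - c) * (mellin f (-z) * (conj (mellin f' (-(1 - conj z))) + s z * conj (mellin f' (-conj z)))) =
      mellin f (-z) * ((z - c) * conj (mellin f' (-(1 - conj z))) + ((z - c) * s z) * conj (mellin f' (-conj z))) := fun z => by ring
  simp_rw [e]
  have hM1 : Tendsto (fun z : ℂ => mellin f (-z)) (𝓝[≠] (c : ℂ)) (𝓝 (mellin f (-(c : ℂ)))) := tendsto_nhdsWithin_of_tendsto_nhds (h1 c).continuousAt.tendsto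
  have hM2 : Tendsto (fun z : ℂ => (z - c) * conj (mellin f' (-(1 - conj z)))) (𝓝[≠] (c : ℂ)) (𝓝 (((c : ℂ) - c) * conj (mellin f' (-(1 - conj (c : ℂ)))))) :=
    tendsto_nhdsWithin_of_tendsto_nhds (((continuous_id.sub continuous_const).mul h2.continuous).tendsto (c : ℂ))
  have hM3 : Tendsto (fun z : ℂ => conj (mellin f' (-conj z))) (𝓝[≠] (c : ℂ)) (𝓝 (conj (mellin f' (-conj (c : ℂ))))) :=
    tendsto_nhdsWithin_of_tendsto_nhds ((h3 (c : ℂ)).continuousAt.tendsto)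
  have h := hM1.mul (hM2.add (hr.mul hM3))
  simp only [sub_self, zero_mul, zero_add, conj_ofReal] at h
  refine h.trans ?_
  rw [show ρ * (mellin f (-(c : ℂ)) * conj (mellin f' (-(c : ℂ)))) = mellin f (-(c : ℂ)) * (ρ * conj (mellin f' (-(c : ℂ)))) by ring]

/-- **UNIFORM `O(y⁻²)` OF THE INTEGRAND ON THE CLOSED STRIP**: `∃ K, ‖F(x+iy)‖ ≤ K∕y²` for `x ∈ [½, σ₀]`, `|y| ≥ 1` — `f̃` is `O(y⁻²)` uniformly, the conjugated Mellin factors are bounded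
(★ T4b §1), `‖s‖ ≤ B` there (§1 closure of the strip letter). [cite: MoeglinWaldspurger1995, II.2.2] -/
theorem exists_norm_innerProductIntegrand_le_div_sq_of_finset (hf : ContDiff ℝ 2 f) (hfs : HasCompactSupport f) (hf0 : tsupport f ⊆ Ioi 0)
    (hf' : ContDiff ℝ 2 f') (hf's : HasCompactSupport f') (hf'0 : tsupport f' ⊆ Ioi 0) (hσ₀ : 1 / 2 < σ₀)
    (hUo : IsOpen U) (hUs : {z : ℂ | 1 / 2 ≤ z.re ∧ z.re ≤ σ₀} ⊆ U) (hs : DifferentiableOn ℂ s (U \ ((S.image fun c : ℝ => (c : ℂ)) : Set ℂ))) (hS : ∀ c ∈ S, 1 / 2 < c)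
    (hB : ∀ z : ℂ, 1 / 2 < z.re → z.re ≤ σ₀ → 1 ≤ |z.im| → ‖s z‖ ≤ B) :
    ∃ K : ℝ, ∀ x ∈ Icc (1 / 2 : ℝ) σ₀, ∀ y : ℝ, 1 ≤ |y| →
      ‖mellin f (-((x : ℂ) + y * I)) * (conj (mellin f' (-(1 - conj ((x : ℂ) + y * I)))) + s ((x : ℂ) + y * I) * conj (mellin f' (-conj ((x : ℂ) + y * I))))‖ ≤ K / y ^ 2 := by
  obtain ⟨B₁, hB₁0, hB₁⟩ := exists_norm_mellin_vertical_le_div_sq_of_mem_Icc hf hfs hf0 (-σ₀) (-(1 / 2 : ℝ))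
  obtain ⟨B₂, hB₂0, hB₂⟩ := exists_norm_mellin_le_of_re_mem_Icc hf'.continuous hf's hf'0 ((1 / 2 : ℝ) - 1) (σ₀ - 1)
  obtain ⟨B₃, hB₃0, hB₃⟩ := exists_norm_mellin_le_of_re_mem_Icc hf'.continuous hf's hf'0 (-σ₀) (-(1 / 2 : ℝ))
  have hBc := norm_le_of_re_mem_Icc_of_finset hUo hUs hs hS hσ₀ hB
  have hB0 : 0 ≤ B := (norm_nonneg _).trans (hB ((σ₀ : ℂ) + (1 : ℝ) * I) (by simp; linarith) (by simp) (by simp))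
  refine ⟨B₁ * (B₂ + B * B₃), fun x hx y hy => ?_⟩
  have hy0 : y ≠ 0 := fun h => by rw [h, abs_zero] at hy; linarith
  have hy2 : 0 < y ^ 2 := by positivity
  have e1 : -((x : ℂ) + y * I) = ((-x : ℝ) : ℂ) + ((-y : ℝ) : ℂ) * I := by push_cast; ring
  have h1 : ‖mellin f (-((x : ℂ) + y * I))‖ ≤ B₁ / y ^ 2 := by
    rw [e1]
    have h := hB₁ (-x) ⟨by linarith [hx.2], by linarith [hx.1]⟩ (-y) (neg_ne_zero.2 hy0)
    rwa [neg_sq] at h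
  have h2 : ‖conj (mellin f' (-(1 - conj ((x : ℂ) + y * I))))‖ ≤ B₂ := by
    rw [RCLike.norm_conj]
    refine hB₂ _ ?_ ?_ <;> simp <;> linarith [hx.1, hx.2]
  have h3 : ‖conj (mellin f' (-conj ((x : ℂ) + y * I)))‖ ≤ B₃ := by
    rw [RCLike.norm_conj]
    refine hB₃ _ ?_ ?_ <;> simp <;> linarith [hx.1, hx.2]
  have h4 : ‖s ((x : ℂ) + y * I)‖ ≤ B := hBc _ (by simpa using hx.1) (by simpa using hx.2) (by simpa using hy)
  calc ‖mellin f (-((x : ℂ) + y * I)) * (conj (mellin f' (-(1 - conj ((x : ℂ) + y * I)))) + s ((x : ℂ) + y * I) * conj (mellin f' (-conj ((x : ℂ) + y * I))))‖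
      ≤ ‖mellin f (-((x : ℂ) + y * I))‖ * (‖conj (mellin f' (-(1 - conj ((x : ℂ) + y * I))))‖ + ‖s ((x : ℂ) + y * I)‖ * ‖conj (mellin f' (-conj ((x : ℂ) + y * I)))‖) := by
        rw [norm_mul]
        refine mul_le_mul_of_nonneg_left ((norm_add_le _ _).trans (add_le_add le_rfl ?_)) (norm_nonneg _)
        rw [norm_mul]
    _ ≤ (B₁ / y ^ 2) * (B₂ + B * B₃) := by
        refine mul_le_mul h1 (add_le_add h2 ?_) (by positivity) (by positivity)
        exact mul_le_mul h4 h3 (norm_nonneg _) hB0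
    _ = B₁ * (B₂ + B * B₃) / y ^ 2 := by ring

/-- **`y ↦ F(σ+iy)` IS INTEGRABLE for every `σ ∈ [½, σ₀]` off the poles** (`σ ∉ S`) — continuous (§1) and `O(y⁻²)`: «`F ∈ L¹` explicit», in particular on the unitary axis `σ = ½`
and on `σ = σ₀`. [cite: MoeglinWaldspurger1995, II.2.2] -/
theorem integrable_innerProductIntegrand_vertical_of_finset (hf : ContDiff ℝ 2 f) (hfs : HasCompactSupport f) (hf0 : tsupport f ⊆ Ioi 0)
    (hf' : ContDiff ℝ 2 f') (hf's : HasCompactSupport f') (hf'0 : tsupport f' ⊆ Ioi 0) (hσ₀ : 1 / 2 < σ₀)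
    (hUo : IsOpen U) (hUs : {z : ℂ | 1 / 2 ≤ z.re ∧ z.re ≤ σ₀} ⊆ U) (hs : DifferentiableOn ℂ s (U \ ((S.image fun c : ℝ => (c : ℂ)) : Set ℂ))) (hS : ∀ c ∈ S, 1 / 2 < c)
    (hB : ∀ z : ℂ, 1 / 2 < z.re → z.re ≤ σ₀ → 1 ≤ |z.im| → ‖s z‖ ≤ B) {σ : ℝ} (hσ₁ : 1 / 2 ≤ σ) (hσ₂ : σ ≤ σ₀) (hσ : ∀ c ∈ S, σ ≠ c) :
    Integrable fun y : ℝ => mellin f (-((σ : ℂ) + y * I)) * (conj (mellin f' (-(1 - conj ((σ : ℂ) + y * I)))) + s ((σ : ℂ) + y * I) * conj (mellin f' (-conj ((σ : ℂ) + y * I)))) := by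
  obtain ⟨K, hK⟩ := exists_norm_innerProductIntegrand_le_div_sq_of_finset hf hfs hf0 hf' hf's hf'0 hσ₀ hUo hUs hs hS hB
  obtain ⟨h2, h3⟩ := differentiable_conj_mellin_reflect hf'.continuous hf's hf'0
  have h1 : Differentiable ℂ fun z : ℂ => mellin f (-z) := (differentiable_mellin hf.continuous hfs hf0).comp differentiable_neg
  have hL : Continuous fun y : ℝ => (σ : ℂ) + y * I := continuous_const.add (continuous_ofReal.mul continuous_const)
  refine integrable_of_continuous_of_sq_decay ?_ (hK σ ⟨hσ₁, hσ₂⟩)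
  exact (h1.continuous.comp hL).mul ((h2.continuous.comp hL).add ((continuous_scalar_vertical_of_finset hUs hs hσ₁ hσ₂ hσ).mul (h3.continuous.comp hL)))

/-- **THE CONTOUR SHIFT OF THE INNER-PRODUCT INTEGRAND ACROSS THE FINSET OF POLES** (★ C4 `integral_vertical_eq_integral_vertical_add_sum_residues` at `σ₁ = ½`, `σ₂ = σ₀`):
`∫_ℝ F(σ₀+iy) dy = ∫_ℝ F(½+iy) dy + 2π·Σ_{c ∈ S} r_c·f̃(c)·conj f̃′(c)`. [cite: MoeglinWaldspurger1995, II.2.4] [cite: Titchmarsh1939, §3.12] -/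
theorem integral_innerProductIntegrand_eq_add_sum_residues (hf : ContDiff ℝ 2 f) (hfs : HasCompactSupport f) (hf0 : tsupport f ⊆ Ioi 0)
    (hf' : ContDiff ℝ 2 f') (hf's : HasCompactSupport f') (hf'0 : tsupport f' ⊆ Ioi 0) (hσ₀ : 1 / 2 < σ₀)
    (hUo : IsOpen U) (hUs : {z : ℂ | 1 / 2 ≤ z.re ∧ z.re ≤ σ₀} ⊆ U) (hs : DifferentiableOn ℂ s (U \ ((S.image fun c : ℝ => (c : ℂ)) : Set ℂ)))
    (hS : ∀ c ∈ S, 1 / 2 < c ∧ c < σ₀) (hr : ∀ c ∈ S, Tendsto (fun z : ℂ => (z - c) * s z) (𝓝[≠] (c : ℂ)) (𝓝 (r c)))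
    (hB : ∀ z : ℂ, 1 / 2 < z.re → z.re ≤ σ₀ → 1 ≤ |z.im| → ‖s z‖ ≤ B) :
    ∫ y : ℝ, mellin f (-((σ₀ : ℂ) + y * I)) * (conj (mellin f' (-(1 - conj ((σ₀ : ℂ) + y * I)))) + s ((σ₀ : ℂ) + y * I) * conj (mellin f' (-conj ((σ₀ : ℂ) + y * I)))) =
      (∫ y : ℝ, mellin f (-((((1 / 2 : ℝ)) : ℂ) + y * I)) *
          (conj (mellin f' (-(1 - conj ((((1 / 2 : ℝ)) : ℂ) + y * I)))) + s ((((1 / 2 : ℝ)) : ℂ) + y * I) * conj (mellin f' (-conj ((((1 / 2 : ℝ)) : ℂ) + y * I))))) +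
        2 * π * ∑ c ∈ S, r c * (mellin f (-(c : ℂ)) * conj (mellin f' (-(c : ℂ)))) := by
  have hS' : ∀ c ∈ S, 1 / 2 < c := fun c hc => (hS c hc).1
  obtain ⟨K, hK⟩ := exists_norm_innerProductIntegrand_le_div_sq_of_finset hf hfs hf0 hf' hf's hf'0 hσ₀ hUo hUs hs hS' hB
  exact integral_vertical_eq_integral_vertical_add_sum_residues (F := fun z : ℂ => mellin f (-z) * (conj (mellin f' (-(1 - conj z))) + s z * conj (mellin f' (-conj z))))
    hσ₀ S hS hUo hUs (differentiableOn_innerProductIntegrand' hf hfs hf0 hf' hf's hf'0 hs)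
    (fun c => r c * (mellin f (-(c : ℂ)) * conj (mellin f' (-(c : ℂ))))) (fun c hc => tendsto_sub_mul_innerProductIntegrand hf hfs hf0 hf' hf's hf'0 (hr c hc))
    (integrable_innerProductIntegrand_vertical_of_finset hf hfs hf0 hf' hf's hf'0 hσ₀ hUo hUs hs hS' hB (le_refl _) hσ₀.le (fun c hc => (hS c hc).1.ne))
    (integrable_innerProductIntegrand_vertical_of_finset hf hfs hf0 hf' hf's hf'0 hσ₀ hUo hUs hs hS' hB hσ₀.le le_rfl (fun c hc => (hS c hc).2.ne')) hK

end Integrand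

/-! ## §3 HEAD: the family's inner product formula moved to the unitary axis — ★ T5a ED. 2's `hIP` -/

/-- **HEAD — THE INNER PRODUCT FORMULA OF A PSEUDO-EISENSTEIN FAMILY ON THE UNITARY AXIS, ACROSS FINITELY MANY SIMPLE REAL POLES (ON LETTERS).**  Data: `f, f′ ∈ C²_c((0,∞))`,
`σ₀ > ½`; the axis scalar `s` with LETTERS `hs` (holomorphic on an open `U ⊇ {½ ≤ Re z ≤ σ₀}` off a finset `S` of REAL poles in `(½, σ₀)`), `hr` (`(z − c)s(z) → r_c` at each
`c ∈ S`), `hB` (`‖s z‖ ≤ B` on `½ < Re z ≤ σ₀, |Im z| ≥ 1` — ★ T1∕T1-χ currency), and the inner-product identity `hIP : IP = C·((2π)⁻¹·∫_ℝ F(σ₀+iy) dy)` with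
`F(z) = f̃(z)·(conj f̃′(1−z̄) + s(z)·conj f̃′(z̄))` spelled verbatim.  CONCLUSION: **`IP = C·(Σ_{c ∈ S} r_c·f̃(c)·conj f̃′(c)) + C·((2π)⁻¹·∫_ℝ F(½+iy) dy)`** — EXACTLY the hypothesis
`hIP` of ★ T5a ED. 2 `plancherelForm_of_innerProductFormula_finset` at `(ι, J, z, ρ, Φ, Ψ, s, k) := (ℝ, S, id, r, mellin f, mellin f′, s, (2π)⁻¹)`; `y ↦ F(½+iy) ∈ L¹` by
`integrable_innerProductIntegrand_vertical_of_finset`.  `S = {1}` is ★ T4b; `S = ∅` (off-dual families) is the plain holomorphic shift.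
[cite: MoeglinWaldspurger1995, II.2.1, II.2.4, IV.1.11] [cite: Titchmarsh1939, §3.12] -/
theorem pseudoEisenstein_contourShift_multi_of_letters {f f' : ℝ → ℂ} (hf : ContDiff ℝ 2 f) (hfs : HasCompactSupport f) (hf0 : tsupport f ⊆ Ioi 0)
    (hf' : ContDiff ℝ 2 f') (hf's : HasCompactSupport f') (hf'0 : tsupport f' ⊆ Ioi 0) {σ₀ : ℝ} (hσ₀ : 1 / 2 < σ₀)
    {s : ℂ → ℂ} {U : Set ℂ} (hUo : IsOpen U) (hUs : {z : ℂ | 1 / 2 ≤ z.re ∧ z.re ≤ σ₀} ⊆ U)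
    (S : Finset ℝ) (hS : ∀ c ∈ S, 1 / 2 < c ∧ c < σ₀) (hs : DifferentiableOn ℂ s (U \ ((S.image fun c : ℝ => (c : ℂ)) : Set ℂ)))
    (r : ℝ → ℂ) (hr : ∀ c ∈ S, Tendsto (fun z : ℂ => (z - c) * s z) (𝓝[≠] (c : ℂ)) (𝓝 (r c)))
    {B : ℝ} (hB : ∀ z : ℂ, 1 / 2 < z.re → z.re ≤ σ₀ → 1 ≤ |z.im| → ‖s z‖ ≤ B)
    {IP C : ℂ} (hIP : IP = C * ((((2 * π)⁻¹ : ℝ) : ℂ) * ∫ y : ℝ, mellin f (-((σ₀ : ℂ) + y * I)) *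
      (conj (mellin f' (-(1 - conj ((σ₀ : ℂ) + y * I)))) + s ((σ₀ : ℂ) + y * I) * conj (mellin f' (-conj ((σ₀ : ℂ) + y * I)))))) :
    IP = C * (∑ c ∈ S, r c * (mellin f (-(c : ℂ)) * conj (mellin f' (-(c : ℂ))))) +
      C * ((((2 * π)⁻¹ : ℝ) : ℂ) * ∫ y : ℝ, mellin f (-((((1 / 2 : ℝ)) : ℂ) + y * I)) *
        (conj (mellin f' (-(1 - conj ((((1 / 2 : ℝ)) : ℂ) + y * I)))) + s ((((1 / 2 : ℝ)) : ℂ) + y * I) * conj (mellin f' (-conj ((((1 / 2 : ℝ)) : ℂ) + y * I))))) := by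
  rw [hIP, integral_innerProductIntegrand_eq_add_sum_residues hf hfs hf0 hf' hf's hf'0 hσ₀ hUo hUs hs hS hr hB]
  have hπ : ((((2 * π)⁻¹ : ℝ) : ℂ)) * (2 * π) = 1 := by
    push_cast
    exact inv_mul_cancel₀ (mul_ne_zero two_ne_zero (ofReal_ne_zero.2 Real.pi_pos.ne'))
  calc C * ((((2 * π)⁻¹ : ℝ) : ℂ) * ((∫ y : ℝ, mellin f (-((((1 / 2 : ℝ)) : ℂ) + y * I)) *
          (conj (mellin f' (-(1 - conj ((((1 / 2 : ℝ)) : ℂ) + y * I)))) + s ((((1 / 2 : ℝ)) : ℂ) + y * I) * conj (mellin f' (-conj ((((1 / 2 : ℝ)) : ℂ) + y * I))))) +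
          2 * π * ∑ c ∈ S, r c * (mellin f (-(c : ℂ)) * conj (mellin f' (-(c : ℂ))))))
      = C * (((((2 * π)⁻¹ : ℝ) : ℂ)) * (2 * π)) * (∑ c ∈ S, r c * (mellin f (-(c : ℂ)) * conj (mellin f' (-(c : ℂ))))) +
          C * ((((2 * π)⁻¹ : ℝ) : ℂ) * ∫ y : ℝ, mellin f (-((((1 / 2 : ℝ)) : ℂ) + y * I)) *
            (conj (mellin f' (-(1 - conj ((((1 / 2 : ℝ)) : ℂ) + y * I)))) + s ((((1 / 2 : ℝ)) : ℂ) + y * I) * conj (mellin f' (-conj ((((1 / 2 : ℝ)) : ℂ) + y * I))))) := by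
        ring
    _ = _ := by rw [hπ, mul_one]

end Summit.HodgeConjecture.HodgeConjecture.Cruxes.H413.K2E1PseudoEisensteinContourShiftMultiCMTwo

end
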